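import Mathlib
import Summits.Schanuel.Schanuel.Theorems.RigidCoreMinimalCounterexampleInAclSecondLevelSelection
import Summits.Schanuel.Schanuel.Theorems.RigidCoreMinimalCounterexampleInAclSelectionCoreTwoSided
import Summits.Schanuel.Schanuel.Theorems.RigidCoreMinimalCounterexampleInAclCosDegenerate
import Summits.Schanuel.Schanuel.Theorems.AclSubsetLogFreeCore.Negative.ExpAclField
import Literature.NumberTheory.Transcendental.LindemannWeierstrassProofs

/-!
# Second-level selection with the TWISTED gadget `2cos x₀ = e^{ix₀} + e^{−ix₀}` — crux stmt-Schanuel-0969 `RigidCore.MinimalCounterexampleInAcl`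

Route `RigidCore`, crux (S*) `MinimalCounterexampleInAcl` (item stmt-Schanuel-0969), line `kernel-arithmetic-selection`
(lead prover-line-stmt-Schanuel-0969-c6-0, skeleton gen 19), `--supports stmt-Schanuel-0969`; registered stub
`stub_secondLevelSelectionCos` (the split `crux_iff_twistedResidue_and_geThree` is in …SecondLevelSplit.lean).

A FIRST-level exponential with an `acl(∅)`-parameter, `e^{ix₀}`, is not constant on the mate class either; the PARAMETER-FREE
symmetrisation `Φ(y) = e^{iy₀} + e^{−iy₀} = 2 cos y₀` (the common value over the two roots of `j² = −1`, hence one `∅`-formula,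
`definableFun_twoCos`) BLOWS UP super-polynomially along the mates of a rank-2 first failure (vertical escape:
`‖2cos y₀‖ ≥ e^{|Im y₀|} − 1`, `|Im y₀| ≥ ‖y₀‖ − O(log ‖y₀‖)`; `stub_cosDegenerate`, Theorems/…CosDegenerate.lean p126061), so the
two-sided selection core (…SelectionCoreTwoSided.lean p125611) applies:

* `secondLevel_cos0`, `secondLevel_cos1`, **`stub_secondLevelSelectionCos`: if `x` is a rank-2 first failure and `e^{ix₀}` or
  `e^{ix₁}` is ALGEBRAIC over `ℚ(x, eˣ)` then `x ∈ acl(∅)²`** (the degenerate case `cos x₀ = 0` puts `x₀ ∈ π(ℤ + ½) ⊆ acl(∅)` and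
  is settled by the landed acl-criterion);
* the split `crux_iff_twistedResidue_and_geThree` ((S*) ⟺ [(S*)₂ for PURE first failures with `e^{x₀²}`, `e^{x₀x₁}`, `e^{x₁²}`,
  `e^{ix₀}`, `e^{ix₁}` ALL transcendental over `ℚ(x, eˣ)`] ∧ item stmt-14744) follows in …SecondLevelSplit.lean.
-/

noncomputable section

set_option linter.dupNamespace false

open Complex Set FirstOrder

namespace Summit.Schanuel.Schanuel.Cruxes.MinimalCounterexampleInAcl.KernelArithmeticSelection

open Literature.NumberTheory.Transcendental (SchanuelRank transcendental_pi_holds)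
open Literature.ModelTheory.ExponentialFields
open Summit.Schanuel.Schanuel.Theorems.AclSubsetLogFreeCore.Negative

/-! ## The parameter-free twisted gadget -/

/-- The roots of `j² = −1` are `±i`. [folklore] -/
theorem eq_I_or_eq_neg_I_of_mul_self {j : ℂ} (hj : j * j = -1) : j = I ∨ j = -I := by
  have h : (j - I) * (j + I) = 0 := by
    have e : (j - I) * (j + I) = j * j - I * I := by ring
    rw [e, hj, Complex.I_mul_I]; ring
  rcases mul_eq_zero.1 h with h1 | h2
  · exact Or.inl (sub_eq_zero.1 h1)
  · exact Or.inr (eq_neg_of_add_eq_zero_left h2)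

/-- **`2cos` is ONE `∅`-formula**: the graph `{(t, v) | v = e^{it} + e^{−it}}` is `∅`-definable in `ℂ_exp` — it is
`∃ j, j² = −1 ∧ v = e^{jt} + e^{−jt}`, the value being the same for both roots. [folklore] -/
theorem definable_twoCosGraph :
    (∅ : Set ℂ).Definable Language.expRing
      {v : Fin 2 → ℂ | v 1 = cexp (I * v 0) + cexp (-(I * v 0))} := by
  have hinner : (∅ : Set ℂ).Definable Language.expRing
      {w : Fin 2 ⊕ Unit → ℂ | (fun (v : Fin 2 → ℂ) (j : ℂ) =>
        j * j = -1 ∧ v 1 = cexp (j * v 0) + cexp (-(j * v 0))) (fun i => w (Sum.inl i)) (w (Sum.inr ()))} := by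
    refine definable_setOf_and_params ?_ ?_
    · exact definable_setOf_eq_params
        (definableFun_mul' (definableFun_proj_params (Sum.inr ())) (definableFun_proj_params (Sum.inr ())))
        (definableFun_neg' definableFun_one')
    · exact definable_setOf_eq_params (definableFun_proj_params (Sum.inl 1))
        (definableFun_add'
          (definableFun_cexp (definableFun_mul' (definableFun_proj_params (Sum.inr ()))
            (definableFun_proj_params (Sum.inl 0))))
          (definableFun_cexp (definableFun_neg' (definableFun_mul' (definableFun_proj_params (Sum.inr ()))
            (definableFun_proj_params (Sum.inl 0))))))
  have h := definable_setOf_exists_params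
    (P := fun (v : Fin 2 → ℂ) (j : ℂ) => j * j = -1 ∧ v 1 = cexp (j * v 0) + cexp (-(j * v 0))) hinner
  convert h using 1
  ext v
  simp only [mem_setOf_eq]
  constructor
  · intro hv
    exact ⟨I, Complex.I_mul_I, hv⟩
  · rintro ⟨j, hj, hv⟩
    rcases eq_I_or_eq_neg_I_of_mul_self hj with rfl | rfl
    · exact hv
    · rw [hv, add_comm]
      congr 1 <;> ring_nf

/-- `y ↦ e^{iy₀} + e^{−iy₀}` is a `∅`-definable function on `ℂ_exp`. [folklore] -/
theorem definableFun_twoCos :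
    (∅ : Set ℂ).DefinableFun Language.expRing (fun y : Fin 2 → ℂ => cexp (I * y 0) + cexp (-(I * y 0))) :=
  definableFun_apply_params (f := fun t : ℂ => cexp (I * t) + cexp (-(I * t))) definable_twoCosGraph
    (definableFun_proj_params 0)

/-- `e^{ix₀}` algebraic over `K` makes `e^{ix₀} + e^{−ix₀}` algebraic over `K`. [folklore] -/
theorem isAlgebraic_twoCos {K : IntermediateField ℚ ℂ} {t : ℂ} (h : IsAlgebraic K (cexp (I * t))) :
    IsAlgebraic K (cexp (I * t) + cexp (-(I * t))) := by
  rw [Complex.exp_neg]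
  exact h.add h.inv

/-- **The degenerate case `cos x₀ = 0`**: then `x₀ ∈ π(ℤ + ½)`, so `x₀` is transcendental and lies in `acl(∅)`.
[cite: Lindemann1882] -/
theorem mem_expAcl_of_twoCos_eq_zero {t : ℂ} (h : cexp (I * t) + cexp (-(I * t)) = 0) :
    t ∈ expAcl ∧ Transcendental ℚ t := by
  -- `e^{2it} = -1 = e^{iπ}`
  have hE : cexp (I * t) ≠ 0 := Complex.exp_ne_zero _
  have hsq : cexp (2 * I * t) = cexp (Real.pi * I) := by
    rw [Complex.exp_pi_mul_I]
    have e : cexp (2 * I * t) = cexp (I * t) * cexp (I * t) := by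
      rw [← Complex.exp_add]; ring_nf
    rw [e]
    have h' : cexp (I * t) = -cexp (-(I * t)) := eq_neg_of_add_eq_zero_left h
    calc cexp (I * t) * cexp (I * t) = cexp (I * t) * -cexp (-(I * t)) := by rw [← h']
      _ = -(cexp (I * t) * cexp (-(I * t))) := by ring
      _ = -1 := by rw [← Complex.exp_add, add_neg_cancel, Complex.exp_zero]
  obtain ⟨n, hn⟩ := Complex.exp_eq_exp_iff_exists_int.1 hsq
  -- solve for `t`
  have ht : t = (Real.pi : ℂ) * (((2 * n + 1 : ℚ) / 2 : ℚ) : ℂ) := by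
    have hI : (I : ℂ) ≠ 0 := Complex.I_ne_zero
    have h2 : (2 : ℂ) * I ≠ 0 := mul_ne_zero two_ne_zero hI
    have e1 : t = (Real.pi * I + n * (2 * Real.pi * I)) / (2 * I) := by
      rw [← hn]; field_simp
    rw [e1]
    push_cast
    field_simp
    ring
  have hq : (((2 * n + 1 : ℚ) / 2 : ℚ) : ℂ) ≠ 0 := by
    have : ((2 * n + 1 : ℚ) / 2 : ℚ) ≠ 0 := by
      have h1 : (2 * (n : ℚ) + 1) ≠ 0 := by
        intro h0
        have : (2 * n + 1 : ℤ) = 0 := by exact_mod_cast h0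
        omega
      exact div_ne_zero h1 two_ne_zero
    exact_mod_cast this
  have hqalg : IsAlgebraic ℚ ((((2 * n + 1 : ℚ) / 2 : ℚ) : ℂ)) := by
    have h := isAlgebraic_algebraMap (R := ℚ) (A := ℂ) ((2 * n + 1 : ℚ) / 2)
    rwa [eq_ratCast] at h
  refine ⟨?_, ?_⟩
  · rw [ht]
    exact mul_mem_expAcl pi_mem_expAcl (mem_expAcl_of_isAlgebraic' hqalg)
  · -- `π = t / q` would be algebraic
    intro halg
    have hpi : IsAlgebraic ℚ ((Real.pi : ℂ)) := by
      have e : (Real.pi : ℂ) = t * ((((2 * n + 1 : ℚ) / 2 : ℚ) : ℂ))⁻¹ := by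
        rw [ht, mul_assoc, mul_inv_cancel₀ hq, mul_one]
      rw [e]
      exact halg.mul hqalg.inv
    have hpiT : Transcendental ℚ ((Real.pi : ℂ)) := by
      have h := (transcendental_algebraMap_iff (R := ℚ) (S := ℝ) (A := ℂ) (a := Real.pi)
        (RCLike.ofReal_injective)).2 transcendental_pi_holds
      simpa using h
    exact hpiT hpi

/-! ## Selection with the twisted gadget -/

/-- **TWISTED SELECTION, first coordinate: if `e^{ix₀}` is algebraic over `ℚ(x, eˣ)` then `x ∈ acl(∅)²`** (rank-2 first failure
`x`; no purity, no finiteness of mates).  `cos x₀ = 0` or `x₀` algebraic: the landed acl-criterion; otherwise the normal form of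
the relation for `2cos x₀`, the blow-up of `2cos y₀` along the mates, growth of the coefficients, local finiteness of the mates and
the two-sided selection core. [cite: KirbyMacintyreOnshuus2012, §2] -/
theorem secondLevel_cos0 {x : Fin 2 → ℂ} (hx : x ∈ firstFailures 2)
    (halg : IsAlgebraic ↥(IntermediateField.adjoin ℚ (range x ∪ range (cexp ∘ x))) (cexp (I * x 0))) :
    ∀ i, x i ∈ expAcl := by
  by_cases hz : cexp (I * x 0) + cexp (-(I * x 0)) = 0
  · obtain ⟨hmem, htr⟩ := mem_expAcl_of_twoCos_eq_zero hz
    exact firstFailure_two_mem_expAcl_of_transcendental_mem hx hmem htr (mem_adjoin_self x 0)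
  by_cases h0 : IsAlgebraic ℚ (x 0)
  · exact firstFailure_two_mem_expAcl_of_isAlgebraic_coord hx h0
  have hx0 : Transcendental ℚ (x 0) := h0
  obtain ⟨d, c, hc0, hrel⟩ := stub_relationNormalForm x _ hz (isAlgebraic_twoCos halg)
  refine selectionCoreTwoSided_of_head hx definableFun_twoCos (fun M => ?_)
    (stub_mateCoeffGrowth x hx.2.1 hx0) (stub_matesLocallyFinite x hx hx0) c hc0 hrel
  obtain ⟨R, hR⟩ := stub_cosDegenerate x hx hx0 M
  exact ⟨R, fun y hy hRy => Or.inr (hR y hy hRy)⟩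

/-- **TWISTED SELECTION, second coordinate: if `e^{ix₁}` is algebraic over `ℚ(x, eˣ)` then `x ∈ acl(∅)²`** (swap +
`secondLevel_cos0`). [cite: KirbyMacintyreOnshuus2012, §2] -/
theorem secondLevel_cos1 {x : Fin 2 → ℂ} (hx : x ∈ firstFailures 2)
    (halg : IsAlgebraic ↥(IntermediateField.adjoin ℚ (range x ∪ range (cexp ∘ x))) (cexp (I * x 1))) :
    ∀ i, x i ∈ expAcl := by
  set x' : Fin 2 → ℂ := x ∘ ⇑(Equiv.swap (0 : Fin 2) 1) with hx'
  have hx'ff : x' ∈ firstFailures 2 := firstFailures_comp_swap hx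
  have halg' : IsAlgebraic ↥(IntermediateField.adjoin ℚ (range x' ∪ range (cexp ∘ x'))) (cexp (I * x' 0)) := by
    rw [hx', adjoin_comp_swap]
    simpa using halg
  have h := secondLevel_cos0 hx'ff halg'
  intro i
  have hi : x i = x' ((Equiv.swap (0 : Fin 2) 1) i) := by
    simp only [hx', Function.comp_apply, Equiv.swap_apply_self]
  rw [hi]
  exact h _

/-! ## The registered stubs -/

/-- **Registered stub `stub_secondLevelSelectionCos` (PROVED): TWISTED SELECTION.**  For a rank-2 first failure `x`: if `e^{ix₀}`
or `e^{ix₁}` is algebraic over `ℚ(x, eˣ)`, then every coordinate of `x` lies in a finite `∅`-definable subset of `ℂ_exp`.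
[cite: KirbyMacintyreOnshuus2012, §2] -/
theorem stub_secondLevelSelectionCos : ∀ (x : Fin 2 → ℂ), x ∈ Summit.Schanuel.Schanuel.Cruxes.MinimalCounterexampleInAcl.KernelArithmeticSelection.firstFailures 2 → (IsAlgebraic ↥(IntermediateField.adjoin ℚ (Set.range x ∪ Set.range (Complex.exp ∘ x))) (Complex.exp (Complex.I * x 0)) ∨ IsAlgebraic ↥(IntermediateField.adjoin ℚ (Set.range x ∪ Set.range (Complex.exp ∘ x))) (Complex.exp (Complex.I * x 1))) → ∀ i, x i ∈ Summit.Schanuel.Schanuel.Theorems.AclSubsetLogFreeCore.Negative.expAcl := by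
  intro x hx h
  rcases h with h0 | h1
  · exact secondLevel_cos0 hx h0
  · exact secondLevel_cos1 hx h1

end Summit.Schanuel.Schanuel.Cruxes.MinimalCounterexampleInAcl.KernelArithmeticSelection

end
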